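import Summits.AtomisticToContinuum.FouriersLaw.Theorems.OddSectorIrreversibilityOddCorrectorDecayKoopman
import Summits.AtomisticToContinuum.FouriersLaw.Theorems.OddCorrectorDecay.Negative.FalseOfLocality
import Summits.AtomisticToContinuum.FouriersLaw.Theorems.BondHeatUncertaintySubdiffusiveBondHeatKernelGibbsD
import Mathlib.Probability.Moments.Variance

/-!
# `OddCorrectorDecay` / Negative: reduction of `¬ OddCorrectorDecay` to ONE fixed-time locality estimate

Support file for item `stmt-AtomisticToContinuum-9139` (`OddSectorIrreversibility.OddCorrectorDecay`), negative
side, prover seat, 2026-08-16. The earlier negative lemma `FalseOfLocality.lean`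
(`oddCorrectorDecay_false_of_oddSectorLocalityHypothesis`) is conditional on the five-clause named fact
`OddSectorLocalityHypothesis`, whose clause (3) is the Girsanov-level generalised detailed balance
`P_t* = ΘP_tΘ` of the constructed kernels and whose clause (4) is Fejér positivity. This file removes both:
the only input left is the FIXED-TIME comparison of the open chain with the CLOSED chain (bath locality),
taken here as an explicit hypothesis of `oddCorrectorDecay_false_of_bathLocality_at` (no new definitions).

## The argument (odd persistence + bath locality)

Write `μ_T = e^{-H_N/T} dq dp`, `J = ∑_i j_i`, `Θ(q,p) = (q,-p)`, `P_t` the equilibrium open-chain kernels,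
`φ_t` the closed Hamiltonian flow (`(pinnedChain ω₂ lam β 0).chainFlow N · 0 t`: zero friction, zero noise).
1. CLASSICAL MECHANICS (`ClosedChainFlow` / `ClosedChainKoopman`): `f ↦ f∘φ_t` and `f ↦ f∘Θ` are linear
   isometries of `L²(μ_T)` (Liouville + `H∘φ_t = H`; `H` even), `φ_{s+t} = φ_t∘φ_s`, `Θφ_tΘφ_t = id`,
   `J∘Θ = -J`. Hence (abstract lemma `OddPersistence.odd_persistence_of_near`, a doubling dichotomy in
   Hilbert space) for ANY curve `a_t` with `‖a_t - J∘φ_t‖_{L²(μ_T)} ≤ δ` on `[0,t₀]`: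
   `∫₀^{t₀} ‖a_t - a_t∘Θ‖ dt ≥ t₀(√M_N/6 - 2δ)`, `M_N = ‖J‖²_{L²(μ_T)}`.
2. FORECASTS ARE IN `L²` (proved here, `memLp_two_currentForecast`): `P_tJ ∈ L²(μ_T)` with
   `‖P_tJ‖ ≤ ‖J‖`, by the kernel Gibbs invariance `μ_T P_t = μ_T`
   (`SubdiffusiveBondHeat.withDensity_gibbsDensity_bind_langevinKernel`) and Jensen (variance ≥ 0) in the
   Markov kernel.
3. BATH LOCALITY (the hypothesis, explicit): for every horizon `t₀` and `ε > 0` some `N` has `M_N > 0` and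
   `‖P_tJ - J∘φ_t‖²_{L²(μ_T)} ≤ ε M_N` on `[0,t₀]` — boundary friction and noise act on two momenta only and
   their influence spreads at finite speed, while `M_N ≍ N`.
With `a_t = P_tJ`, `ε = 1/576` (`δ = √M_N/24`) and `t₀ = 12 max(C,0) + 12`, the crux's bound
`∫₀^∞ ‖P_tJ - (P_tJ)∘Θ‖ ≤ C√M_N` gives `t₀√M_N/12 ≤ C√M_N`, i.e. `max(C,0) + 1 ≤ C`: contradiction.

## Contents
* `gibbsWeight_bind_transitionKernel`, `lintegral_transitionKernel_gibbsWeight` — `μ_T P_t = μ_T`.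
* `memLp_two_currentForecast` — `P_tJ ∈ L²(μ_T)`, `‖P_tJ‖² ≤ ‖J‖²` (PROVED).
* `oddCorrectorDecay_false_of_bathLocality_at` — bath locality at one admissible point `⇒ ¬ OddCorrectorDecay`.
-/

noncomputable section

open MeasureTheory ProbabilityTheory Filter Topology Set Function
open scoped NNReal ENNReal
open Literature.MathematicalPhysics.KineticTheory Literature.MathematicalPhysics.KineticTheory.HeatConduction
open Literature.MathematicalPhysics.KineticTheory.OddSectorLocality
open Summit.AtomisticToContinuum.FouriersLaw.Theses.OddSectorIrreversibility (OddCorrectorDecay)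
open Summit.AtomisticToContinuum.FouriersLaw.Theorems.ClosedChainFlow
open Summit.AtomisticToContinuum.FouriersLaw.Theorems.ClosedChainKoopman
open Summit.AtomisticToContinuum.FouriersLaw.Theorems.SubdiffusiveBondHeat
  (pinnedChain_isConfining pinnedChain_langevinKernel_eq_transitionKernel withDensity_gibbsDensity_bind_langevinKernel)

namespace Summit.AtomisticToContinuum.FouriersLaw.Theorems.OddCorrectorBathLocality

/-! ### The open-chain forecast of the current is in `L²(μ_T)` -/

section Forecast

variable {ω₂ lam β γ : ℝ} (hω : 0 < ω₂) (hl : 0 ≤ lam) (hβ : 0 ≤ β) (hγ : 0 ≤ γ) {N : ℕ} (hN : 0 < N)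
  {T : ℝ} (hT : 0 < T)
include hω hl hβ hγ hN hT

/-- **Kernel Gibbs invariance of the crux's weight**: `μ_T ∘ P_t = μ_T` for the constructed equilibrium kernels
(`SubdiffusiveBondHeat.withDensity_gibbsDensity_bind_langevinKernel` transported to `transitionKernel` and to
`OddSectorLocality.gibbsWeight`). [cite: CuneoEckmannHairerReyBellet2018, §3.1] -/
theorem gibbsWeight_bind_transitionKernel (t : ℝ≥0) :
    (gibbsWeight ω₂ lam β γ T N).bind ((pinnedChain ω₂ lam β γ).transitionKernel N T T t) =
      gibbsWeight ω₂ lam β γ T N := by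
  rw [← pinnedChain_langevinKernel_eq_transitionKernel N T T hω hl hβ hγ t]
  exact withDensity_gibbsDensity_bind_langevinKernel (pinnedChain_isConfining hω hl hβ hγ)
    (pinnedChain_contDiff_U ω₂ lam β γ) (pinnedChain_contDiff_V ω₂ lam β γ) hN hT t

/-- Invariance in Lebesgue-integral form: `∫⁻ (∫⁻ g dP_t(x,·)) dμ_T(x) = ∫⁻ g dμ_T` for measurable `g ≥ 0`.
[folklore] -/
theorem lintegral_transitionKernel_gibbsWeight (t : ℝ≥0) {g : PhaseSpace N → ℝ≥0∞} (hg : Measurable g) :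
    ∫⁻ x, (∫⁻ y, g y ∂((pinnedChain ω₂ lam β γ).transitionKernel N T T t x)) ∂(gibbsWeight ω₂ lam β γ T N) =
      ∫⁻ y, g y ∂(gibbsWeight ω₂ lam β γ T N) := by
  have h := gibbsWeight_bind_transitionKernel hω hl hβ hγ hN hT t
  conv_rhs => rw [← h]
  rw [Measure.lintegral_bind (ProbabilityTheory.Kernel.measurable _).aemeasurable hg.aemeasurable]

/-- **The forecast `P_tJ` is square integrable against `μ_T`, with `∫ (P_tJ)² dμ_T ≤ ∫ J² dμ_T`**
(Jensen in the Markov kernel — the variance of `J` under `P_t(x,·)` is nonnegative — and kernel Gibbs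
invariance; both as Lebesgue integrals, so no Bochner junk value intervenes). [folklore] -/
theorem memLp_two_currentForecast (t : ℝ) :
    MemLp (currentForecast ω₂ lam β γ T N t) 2 (gibbsWeight ω₂ lam β γ T N) ∧
      ∫ x, (currentForecast ω₂ lam β γ T N t x) ^ 2 ∂(gibbsWeight ω₂ lam β γ T N) ≤
        currentNormSq ω₂ lam β γ T N := by
  set μ : Measure (PhaseSpace N) := gibbsWeight ω₂ lam β γ T N with hμ
  set κ := (pinnedChain ω₂ lam β γ).transitionKernel N T T t.toNNReal with hκ
  set J : PhaseSpace N → ℝ := fun x => ∑ i : Fin N, (pinnedChain ω₂ lam β γ).bondCurrent N i x with hJ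
  haveI : IsMarkovKernel κ := pinnedChain_isMarkovKernel_transitionKernel hω hl hβ hγ N T T _
  have hJc : Continuous J := continuous_finsetSum _ fun i _ => pinnedChain_continuous_bondCurrent ω₂ lam β γ N i
  have hJm : Measurable J := hJc.measurable
  have hJmem : MemLp J 2 μ := memLp_two_totalCurrent hω hl hβ γ N hT
  -- the forecast and its measurability
  have hcf : currentForecast ω₂ lam β γ T N t = fun x => ∫ y, J y ∂κ x := rfl
  have hcfm : StronglyMeasurable fun x => ∫ y, J y ∂κ x := hJc.stronglyMeasurable.integral_kernel
  -- `∫⁻∫⁻ J² dκ dμ = ∫⁻ J² dμ < ∞`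
  have hg : Measurable fun y => ENNReal.ofReal (J y ^ 2) := (hJm.pow_const 2).ennreal_ofReal
  have hinv := lintegral_transitionKernel_gibbsWeight hω hl hβ hγ hN hT t.toNNReal hg
  have hfin : ∫⁻ y, ENNReal.ofReal (J y ^ 2) ∂μ < ∞ := by
    have h := hJmem.integrable_sq.hasFiniteIntegral
    rw [hasFiniteIntegral_iff_ofReal (Eventually.of_forall fun x => sq_nonneg (J x))] at h
    exact h
  -- for `μ`-a.e. `x`, `J ∈ L²(κ x)` and Jensen holds
  have hae : ∀ᵐ x ∂μ, ∫⁻ y, ENNReal.ofReal (J y ^ 2) ∂κ x < ∞ := by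
    refine ae_lt_top (hg.lintegral_kernel) ?_
    rw [hinv]; exact hfin.ne
  have hjensen : ∀ᵐ x ∂μ, ENNReal.ofReal ((∫ y, J y ∂κ x) ^ 2) ≤ ∫⁻ y, ENNReal.ofReal (J y ^ 2) ∂κ x := by
    refine hae.mono fun x hx => ?_
    have hmem : MemLp J 2 (κ x) := by
      rw [memLp_two_iff_integrable_sq hJc.aestronglyMeasurable]
      refine ⟨(hJm.pow_const 2).aestronglyMeasurable, ?_⟩
      rw [hasFiniteIntegral_iff_ofReal (Eventually.of_forall fun y => sq_nonneg (J y))]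
      exact hx
    have hvar := variance_nonneg J (κ x)
    rw [variance_eq_sub hmem] at hvar
    have hle : (∫ y, J y ∂κ x) ^ 2 ≤ ∫ y, J y ^ 2 ∂κ x := by
      have : (κ x)[J ^ 2] = ∫ y, J y ^ 2 ∂κ x := rfl
      linarith
    rw [← ofReal_integral_eq_lintegral_ofReal hmem.integrable_sq (Eventually.of_forall fun y => sq_nonneg _)]
    exact ENNReal.ofReal_le_ofReal hle
  -- the Lebesgue bound `∫⁻ (P_tJ)² dμ ≤ ∫⁻ J² dμ`
  have hlint : ∫⁻ x, ENNReal.ofReal ((∫ y, J y ∂κ x) ^ 2) ∂μ ≤ ∫⁻ y, ENNReal.ofReal (J y ^ 2) ∂μ := by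
    calc ∫⁻ x, ENNReal.ofReal ((∫ y, J y ∂κ x) ^ 2) ∂μ ≤ ∫⁻ x, ∫⁻ y, ENNReal.ofReal (J y ^ 2) ∂κ x ∂μ :=
          lintegral_mono_ae hjensen
      _ = ∫⁻ y, ENNReal.ofReal (J y ^ 2) ∂μ := hinv
  have hint2 : Integrable (fun x => (∫ y, J y ∂κ x) ^ 2) μ := by
    refine ⟨(hcfm.measurable.pow_const 2).aestronglyMeasurable, ?_⟩
    rw [hasFiniteIntegral_iff_ofReal (Eventually.of_forall fun x => sq_nonneg _)]
    exact lt_of_le_of_lt hlint hfin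
  have hmemcf : MemLp (fun x => ∫ y, J y ∂κ x) 2 μ :=
    (memLp_two_iff_integrable_sq hcfm.aestronglyMeasurable).2 hint2
  refine ⟨hcf ▸ hmemcf, ?_⟩
  -- the Bochner bound
  have h1 : ENNReal.ofReal (∫ x, (∫ y, J y ∂κ x) ^ 2 ∂μ) ≤ ENNReal.ofReal (∫ y, J y ^ 2 ∂μ) := by
    rw [ofReal_integral_eq_lintegral_ofReal hint2 (Eventually.of_forall fun x => sq_nonneg _),
      ofReal_integral_eq_lintegral_ofReal hJmem.integrable_sq (Eventually.of_forall fun x => sq_nonneg _)]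
    exact hlint
  have h2 : 0 ≤ ∫ y, J y ^ 2 ∂μ := integral_nonneg fun y => sq_nonneg _
  exact (ENNReal.ofReal_le_ofReal_iff h2).1 h1

end Forecast


/-! ### The negative lemma -/

section Negative

/-- **`OddCorrectorDecay` is false given bath locality at ONE admissible parameter point** (hypothesis spelled
out): if at `ω₂, lam, β, γ, T > 0`, for every horizon `t₀ > 0` and every `ε > 0` some `N` has `M_N > 0` and
`∫ (P_tJ - J∘φ_t)² dμ_T ≤ ε M_N` on `[0, t₀]`, then `OddCorrectorDecay` fails. Proof: odd persistence of the
closed chain (`ClosedChainKoopman.odd_persistence_closedChain`) with the forecast curve `a_t = P_tJ ∈ L²(μ_T)`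
(`memLp_two_currentForecast`), `ε = 1/576`, `t₀ = 12 max(C,0) + 12`, against the crux's bound
`∫_{(0,∞)} ‖P_tJ - (P_tJ)∘Θ‖ ≤ C √M_N`. [folklore] -/
theorem oddCorrectorDecay_false_of_bathLocality_at {ω₂ lam β γ T : ℝ} (hω : 0 < ω₂) (hl : 0 < lam)
    (hβ : 0 < β) (hγ : 0 < γ) (hT : 0 < T)
    (hBL : ∀ t₀ : ℝ, 0 < t₀ → ∀ ε : ℝ, 0 < ε → ∃ N : ℕ, 0 < currentNormSq ω₂ lam β γ T N ∧
      ∀ t ∈ Icc (0:ℝ) t₀,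
        ∫ x, (currentForecast ω₂ lam β γ T N t x -
            ∑ i : Fin N, (pinnedChain ω₂ lam β γ).bondCurrent N i
              ((pinnedChain ω₂ lam β 0).chainFlow N x 0 t)) ^ 2 ∂(gibbsWeight ω₂ lam β γ T N) ≤
          ε * currentNormSq ω₂ lam β γ T N) :
    ¬ OddCorrectorDecay := by
  intro hOSD
  obtain ⟨C, hC⟩ := (OddSectorLocality.oddCorrectorDecay_iff.1 hOSD) ω₂ lam β γ hω hl hβ hγ T hT
  set t₀ : ℝ := 12 * max C 0 + 12 with ht₀def
  have hmax : 0 ≤ max C 0 := le_max_right _ _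
  have ht₀ : 0 < t₀ := by rw [ht₀def]; linarith
  obtain ⟨N, hM, hloc⟩ := hBL t₀ ht₀ (1 / 576) (by norm_num)
  have hN : 0 < N := by
    rcases Nat.eq_zero_or_pos N with h | h
    · exfalso
      subst h
      simp [currentNormSq] at hM
    · exact h
  obtain ⟨hint, hle⟩ := hC N
  set M := currentNormSq ω₂ lam β γ T N with hMdef
  have hsq : 0 < Real.sqrt M := Real.sqrt_pos.2 hM
  -- the crux integrand is the odd-part norm of the forecast curve
  have hai : IntervalIntegrable (fun t => Real.sqrt (∫ x, (currentForecast ω₂ lam β γ T N t x -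
      currentForecast ω₂ lam β γ T N t (x.1, -x.2)) ^ 2 ∂(gibbsWeight ω₂ lam β γ T N))) volume 0 t₀ :=
    (intervalIntegrable_iff_integrableOn_Ioc_of_le ht₀.le).2 (hint.mono_set Ioc_subset_Ioi_self)
  -- odd persistence of the closed chain against the forecast curve, `δ = √M / 24`
  have hδ : 0 ≤ Real.sqrt M / 24 := by positivity
  have key := odd_persistence_closedChain hω hl.le hβ.le γ hN hT ht₀.le hδ
    (fun t => currentForecast ω₂ lam β γ T N t)
    (fun t _ => (memLp_two_currentForecast hω hl.le hβ.le hγ.le hN hT t).1)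
    (fun t ht => (hloc t ht).trans (le_of_eq (by rw [div_pow, Real.sq_sqrt hM.le]; ring))) hai
  -- compare with the crux's bound
  have hF0 : ∀ t, 0 ≤ Real.sqrt (oddPartNormSq ω₂ lam β γ T N t) := fun t => Real.sqrt_nonneg _
  have h2 : ∫ t in (0:ℝ)..t₀, Real.sqrt (oddPartNormSq ω₂ lam β γ T N t) ≤
      ∫ t in Ioi 0, Real.sqrt (oddPartNormSq ω₂ lam β γ T N t) := by
    rw [intervalIntegral.integral_of_le ht₀.le]
    exact setIntegral_mono_set hint (ae_of_all _ hF0) Ioc_subset_Ioi_self.eventuallyLE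
  have h3 : t₀ * (Real.sqrt M / 6 - 2 * (Real.sqrt M / 24)) = (max C 0 + 1) * Real.sqrt M := by
    rw [ht₀def]; ring
  have h4 : (max C 0 + 1) * Real.sqrt M ≤ C * Real.sqrt M := by
    rw [← h3]
    exact key.trans (h2.trans hle)
  have h5 := le_of_mul_le_mul_right h4 hsq
  linarith [le_max_left C 0]

end Negative

end Summit.AtomisticToContinuum.FouriersLaw.Theorems.OddCorrectorBathLocality

end
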